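import Summits.Ventures.PercRepro.RankDistBookProfile

/-!
# PercRepro — COUNTING SUBSETS OF THE BOOK BY THEIR PATTERN (p9, gen 23)

A subset `A ⊆ range f` of the book is determined by its pattern `(ε, g)`: `ε = decide (e₀ ∈ A)` and the page
pattern `g = bookPg f A : Fin k → Finset Bool` (the elements of each pair that lie in `A`); `bookOf ε g` is the
inverse. Hence `card_filter_book`: **the subsets of `E` whose pattern satisfies `P` are as many as the patterns
satisfying `P`**, and such patterns are counted with `Fintype.piFinset`: every page nonempty (`3^k`,
`card_pg_nonempty`), every page a singleton (`2^k`, `card_pg_singleton`), every page nonempty and some page full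
(`3^k − 2^k`, `card_pg_nonempty_full`), exactly one empty page (`k · 3^{k−1}`, `card_pg_one_empty`).
`RankDistBookLevels` applies this to the two shadow levels of the tight layer. Nothing here moves any window of
the crux.
-/

namespace PercRepro.RankDist

open Set Finset _root_.Matroid PercRepro.ThmH

variable {α : Type} [DecidableEq α] {k : ℕ} (f : Option (Fin k × Bool) → α)

/-! ## The pattern of a subset of `range f` as a pair `(ε, g)` -/

open scoped Classical in
/-- The page pattern of a set: for each pair `i`, the elements of the pair that lie in `A`. -/
noncomputable def bookPg (A : Set α) (i : Fin k) : Finset Bool := Finset.univ.filter (fun b => f (some (i, b)) ∈ A)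

/-- The subset of `range f` with the pattern `(ε, g)`. -/
def bookOf (ε : Bool) (g : Fin k → Finset Bool) : Set α :=
  f '' {y : Option (Fin k × Bool) | y.elim (ε = true) (fun ib => ib.2 ∈ g ib.1)}

omit [DecidableEq α] in
/-- Membership of a page element in `bookPg`. -/
lemma mem_bookPg {A : Set α} {i : Fin k} {b : Bool} : b ∈ bookPg f A i ↔ f (some (i, b)) ∈ A := by
  unfold bookPg; simp

omit [DecidableEq α] in
/-- `bookOf ε g ⊆ range f`. -/
lemma bookOf_subset_range (ε : Bool) (g : Fin k → Finset Bool) : bookOf f ε g ⊆ Set.range f :=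
  Set.image_subset_range _ _

omit [DecidableEq α] in
/-- `e₀ ∈ bookOf ε g` iff `ε = true`. -/
lemma none_mem_bookOf (hf : Function.Injective f) (ε : Bool) (g : Fin k → Finset Bool) :
    f none ∈ bookOf f ε g ↔ ε = true := by
  unfold bookOf
  constructor
  · rintro ⟨y, hy, hyx⟩
    have := hf hyx
    subst this
    simpa using hy
  · intro h
    exact ⟨none, by simpa using h, rfl⟩

omit [DecidableEq α] in
/-- A page element lies in `bookOf ε g` iff the pattern says so. -/
lemma some_mem_bookOf (hf : Function.Injective f) (ε : Bool) (g : Fin k → Finset Bool) (i : Fin k) (b : Bool) :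
    f (some (i, b)) ∈ bookOf f ε g ↔ b ∈ g i := by
  unfold bookOf
  constructor
  · rintro ⟨y, hy, hyx⟩
    have := hf hyx
    subst this
    simpa using hy
  · intro h
    exact ⟨some (i, b), by simpa using h, rfl⟩

omit [DecidableEq α] in
/-- The page pattern of `bookOf ε g` is `g`. -/
lemma bookPg_bookOf (hf : Function.Injective f) (ε : Bool) (g : Fin k → Finset Bool) :
    bookPg f (bookOf f ε g) = g := by
  funext i
  ext b
  rw [mem_bookPg, some_mem_bookOf f hf]

omit [DecidableEq α] in
open scoped Classical in
/-- A subset of `range f` is `bookOf` of its pattern. -/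
lemma bookOf_bookPg {A : Set α} (hA : A ⊆ Set.range f) :
    bookOf f (decide (f none ∈ A)) (bookPg f A) = A := by
  ext x
  constructor
  · intro hx
    obtain ⟨y, hy, rfl⟩ := hx
    rcases y with _ | ⟨i, b⟩
    · simpa using hy
    · simp only [Set.mem_setOf_eq, Option.elim, mem_bookPg] at hy
      exact hy
  · intro hx
    obtain ⟨y, rfl⟩ := hA hx
    rcases y with _ | ⟨i, b⟩
    · exact ⟨none, by simpa using hx, rfl⟩
    · exact ⟨some (i, b), by simpa [mem_bookPg] using hx, rfl⟩

omit [DecidableEq α] in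
/-- The pairs missed by `A` are the empty pages. -/
lemma bookMiss_eq_filter_pg (A : Set α) :
    bookMiss f A = Finset.univ.filter (fun i => bookPg f A i = ∅) := by
  ext i
  simp only [mem_bookMiss, Finset.mem_filter, Finset.mem_univ, true_and, Finset.eq_empty_iff_forall_notMem,
    mem_bookPg]
  constructor
  · rintro ⟨h0, h1⟩ b
    cases b
    · exact h0
    · exact h1
  · intro h
    exact ⟨h false, h true⟩

omit [DecidableEq α] in
/-- The full pairs of `A` are the full pages. -/
lemma bookFull_eq_filter_pg (A : Set α) :
    bookFull f A = Finset.univ.filter (fun i => bookPg f A i = Finset.univ) := by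
  ext i
  simp only [mem_bookFull, Finset.mem_filter, Finset.mem_univ, true_and, Finset.eq_univ_iff_forall, mem_bookPg]
  constructor
  · rintro ⟨h0, h1⟩ b
    cases b
    · exact h0
    · exact h1
  · intro h
    exact ⟨h false, h true⟩

omit [DecidableEq α] in
open scoped Classical in
/-- `[e₀ ∈ A] = 1` iff `decide (e₀ ∈ A) = true`. -/
lemma bookSp_eq_one_iff_decide (A : Set α) : bookSp f A = 1 ↔ decide (f none ∈ A) = true := by
  rw [bookSp_eq_one_iff, decide_eq_true_iff]

omit [DecidableEq α] in
open scoped Classical in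
/-- `[e₀ ∈ A] = 0` iff `decide (e₀ ∈ A) = false`. -/
lemma bookSp_eq_zero_iff_decide (A : Set α) : bookSp f A = 0 ↔ decide (f none ∈ A) = false := by
  rw [bookSp_eq_zero_iff, decide_eq_false_iff_not]

omit [DecidableEq α] in
open scoped Classical in
/-- **Counting subsets of the book by their pattern**: the subsets `A ⊆ E` whose pattern satisfies `P` are as many
as the patterns satisfying `P`. -/
theorem card_filter_book (hf : Function.Injective f) (P : Bool → (Fin k → Finset Bool) → Prop) :
    ((subsetsFin (book f hf)).filter (fun A => P (decide (f none ∈ A)) (bookPg f A))).card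
      = ((Finset.univ : Finset (Bool × (Fin k → Finset Bool))).filter (fun x => P x.1 x.2)).card := by
  refine Finset.card_nbij' (fun A => (decide (f none ∈ A), bookPg f A)) (fun x => bookOf f x.1 x.2) ?_ ?_ ?_ ?_
  · intro A hA
    rw [Finset.mem_coe, Finset.mem_filter] at hA
    rw [Finset.mem_coe, Finset.mem_filter]
    exact ⟨Finset.mem_univ _, hA.2⟩
  · intro x hx
    rw [Finset.mem_coe, Finset.mem_filter] at hx
    rw [Finset.mem_coe, Finset.mem_filter, mem_subsetsFin, book_ground]
    refine ⟨bookOf_subset_range f _ _, ?_⟩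
    have h1 : decide (f none ∈ bookOf f x.1 x.2) = x.1 := by
      rcases hx1 : x.1 with _ | _
      · rw [decide_eq_false_iff_not, none_mem_bookOf f hf]; exact Bool.false_ne_true
      · rw [decide_eq_true_iff, none_mem_bookOf f hf]
    rw [h1, bookPg_bookOf f hf]
    exact hx.2
  · intro A hA
    rw [Finset.mem_coe, Finset.mem_filter, mem_subsetsFin, book_ground] at hA
    exact bookOf_bookPg f hA.1
  · intro x _
    have h1 : decide (f none ∈ bookOf f x.1 x.2) = x.1 := by
      rcases hx1 : x.1 with _ | _
      · rw [decide_eq_false_iff_not, none_mem_bookOf f hf]; exact Bool.false_ne_true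
      · rw [decide_eq_true_iff, none_mem_bookOf f hf]
    show (decide (f none ∈ bookOf f x.1 x.2), bookPg f (bookOf f x.1 x.2)) = x
    rw [h1, bookPg_bookOf f hf]

/-! ## Counting patterns -/

omit [DecidableEq α] in
open scoped Classical in
/-- A predicate on `Bool × β` is counted by its two fibres. -/
lemma card_filter_bool_prod {β : Type} [Fintype β] (P : Bool → β → Prop) :
    ((Finset.univ : Finset (Bool × β)).filter (fun x => P x.1 x.2)).card
      = ((Finset.univ : Finset β).filter (fun g => P true g)).card
        + ((Finset.univ : Finset β).filter (fun g => P false g)).card := by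
  rw [Finset.card_filter, Finset.card_filter, Finset.card_filter, Fintype.sum_prod_type, Fintype.sum_bool]

/-- The nonempty subsets of `Bool`: three. -/
lemma card_nonempty_finset_bool : ((Finset.univ : Finset (Finset Bool)).filter (fun s => s ≠ ∅)).card = 3 := by
  decide

/-- The singletons of `Bool`: two. -/
lemma card_singleton_finset_bool : ((Finset.univ : Finset (Finset Bool)).filter (fun s => s.card = 1)).card = 2 := by
  decide

/-- A subset of `Bool` is a singleton iff it is neither empty nor full. -/
lemma card_eq_one_iff_finset_bool (s : Finset Bool) : s.card = 1 ↔ s ≠ ∅ ∧ s ≠ Finset.univ := by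
  revert s; decide

/-- Patterns with every page nonempty: `3^k`. -/
lemma card_pg_nonempty :
    ((Finset.univ : Finset (Fin k → Finset Bool)).filter (fun g => ∀ i, g i ≠ ∅)).card = 3 ^ k := by
  have e : (Finset.univ : Finset (Fin k → Finset Bool)).filter (fun g => ∀ i, g i ≠ ∅)
      = Fintype.piFinset (fun _ : Fin k => (Finset.univ : Finset (Finset Bool)).filter (fun s => s ≠ ∅)) := by
    ext g
    rw [Finset.mem_filter, Fintype.mem_piFinset]
    simp only [Finset.mem_univ, true_and, Finset.mem_filter]
  rw [e, Fintype.card_piFinset_const, card_nonempty_finset_bool]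

/-- Patterns with every page a singleton: `2^k`. -/
lemma card_pg_singleton :
    ((Finset.univ : Finset (Fin k → Finset Bool)).filter (fun g => ∀ i, (g i).card = 1)).card = 2 ^ k := by
  have e : (Finset.univ : Finset (Fin k → Finset Bool)).filter (fun g => ∀ i, (g i).card = 1)
      = Fintype.piFinset (fun _ : Fin k => (Finset.univ : Finset (Finset Bool)).filter (fun s => s.card = 1)) := by
    ext g
    rw [Finset.mem_filter, Fintype.mem_piFinset]
    simp only [Finset.mem_univ, true_and, Finset.mem_filter]
  rw [e, Fintype.card_piFinset_const, card_singleton_finset_bool]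

/-- Patterns with every page nonempty and some page full: `3^k − 2^k`. -/
lemma card_pg_nonempty_full :
    ((Finset.univ : Finset (Fin k → Finset Bool)).filter
      (fun g => (∀ i, g i ≠ ∅) ∧ ∃ i, g i = Finset.univ)).card = 3 ^ k - 2 ^ k := by
  have h := Finset.card_filter_add_card_filter_not
    (s := (Finset.univ : Finset (Fin k → Finset Bool)).filter (fun g => ∀ i, g i ≠ ∅))
    (p := fun g => ∃ i, g i = Finset.univ)
  rw [Finset.filter_filter, Finset.filter_filter, card_pg_nonempty] at h
  have e : (Finset.univ : Finset (Fin k → Finset Bool)).filter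
      (fun g => (∀ i, g i ≠ ∅) ∧ ¬ ∃ i, g i = Finset.univ)
      = (Finset.univ : Finset (Fin k → Finset Bool)).filter (fun g => ∀ i, (g i).card = 1) := by
    ext g
    simp only [Finset.mem_filter, Finset.mem_univ, true_and, not_exists]
    constructor
    · rintro ⟨h1, h2⟩ i
      exact (card_eq_one_iff_finset_bool _).2 ⟨h1 i, h2 i⟩
    · intro h
      exact ⟨fun i => ((card_eq_one_iff_finset_bool _).1 (h i)).1,
        fun i => ((card_eq_one_iff_finset_bool _).1 (h i)).2⟩
  rw [e, card_pg_singleton] at h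
  omega

/-- The patterns with the page `i₀` empty and every other page nonempty: `3^{k−1}`. -/
lemma card_piFinset_one_empty (i₀ : Fin k) :
    (Fintype.piFinset (fun i : Fin k => if i = i₀ then ({∅} : Finset (Finset Bool))
      else (Finset.univ : Finset (Finset Bool)).filter (fun s => s ≠ ∅))).card = 3 ^ (k - 1) := by
  rw [Fintype.card_piFinset]
  have e : ∀ i : Fin k, (if i = i₀ then ({∅} : Finset (Finset Bool))
      else (Finset.univ : Finset (Finset Bool)).filter (fun s => s ≠ ∅)).card = if i = i₀ then 1 else 3 := by
    intro i
    split_ifs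
    · exact Finset.card_singleton _
    · exact card_nonempty_finset_bool
  simp_rw [e]
  rw [Finset.prod_ite, Finset.prod_const, Finset.prod_const, Finset.filter_eq', if_pos (Finset.mem_univ _),
    Finset.filter_ne', Finset.card_singleton, Finset.card_erase_of_mem (Finset.mem_univ _), Finset.card_univ,
    Fintype.card_fin, one_pow, one_mul]

/-- Patterns with exactly one empty page: `k · 3^{k−1}`. -/
lemma card_pg_one_empty :
    ((Finset.univ : Finset (Fin k → Finset Bool)).filter
      (fun g => (Finset.univ.filter (fun i => g i = ∅)).card = 1)).card = k * 3 ^ (k - 1) := by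
  classical
  have e : (Finset.univ : Finset (Fin k → Finset Bool)).filter
        (fun g => (Finset.univ.filter (fun i => g i = ∅)).card = 1)
      = Finset.univ.biUnion (fun i₀ : Fin k => Fintype.piFinset (fun i : Fin k =>
          if i = i₀ then ({∅} : Finset (Finset Bool))
          else (Finset.univ : Finset (Finset Bool)).filter (fun s => s ≠ ∅))) := by
    ext g
    simp only [Finset.mem_filter, Finset.mem_univ, true_and, Finset.mem_biUnion, Fintype.mem_piFinset]
    rw [Finset.card_eq_one]
    constructor
    · rintro ⟨i₀, hi₀⟩
      have hmem : ∀ i, g i = ∅ ↔ i = i₀ := by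
        intro i
        have h' : i ∈ Finset.univ.filter (fun i => g i = ∅) ↔ i ∈ ({i₀} : Finset (Fin k)) := by rw [hi₀]
        rw [Finset.mem_filter, Finset.mem_singleton] at h'
        simpa using h'
      refine ⟨i₀, fun i => ?_⟩
      by_cases h : i = i₀
      · rw [if_pos h, Finset.mem_singleton]
        exact (hmem i).2 h
      · rw [if_neg h, Finset.mem_filter]
        exact ⟨Finset.mem_univ _, fun h' => h ((hmem i).1 h')⟩
    · rintro ⟨i₀, h⟩
      refine ⟨i₀, ?_⟩
      ext i
      simp only [Finset.mem_filter, Finset.mem_univ, true_and, Finset.mem_singleton]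
      have hi := h i
      by_cases hii : i = i₀
      · rw [if_pos hii, Finset.mem_singleton] at hi
        exact ⟨fun _ => hii, fun _ => hi⟩
      · rw [if_neg hii, Finset.mem_filter] at hi
        exact ⟨fun h' => absurd h' hi.2, fun h' => absurd h' hii⟩
  rw [e, Finset.card_biUnion]
  · simp_rw [card_piFinset_one_empty]
    rw [Finset.sum_const, Finset.card_univ, Fintype.card_fin, smul_eq_mul]
  · intro i₀ _ i₁ _ hne
    rw [Function.onFun, Finset.disjoint_left]
    intro g hg₀ hg₁
    rw [Fintype.mem_piFinset] at hg₀ hg₁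
    have h0 := hg₀ i₀
    have h1 := hg₁ i₀
    rw [if_pos rfl, Finset.mem_singleton] at h0
    rw [if_neg hne, Finset.mem_filter] at h1
    exact h1.2 h0

end PercRepro.RankDist
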